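import Summits.ABC.IUTFork.Conditional.WRowLicenceTripleSocketMLocalTypeDiff
import Summits.ABC.IUTFork.Cor312GenuineKWildDifferentExactTriple
import Summits.ABC.IUTFork.Cor312GenuineKWildExactTriple
import Summits.ABC.IUTFork.Conditional.RefBandsInhCells289111328125Diff
import Summits.ABC.IUTFork.Conditional.AbcOfSGenuineKLinUniformRows6
import Summits.ABC.IUTFork.Conditional.RefBandsInhCells99794037551104Diff
import Summits.ABC.IUTFork.Conditional.AbcOfSGenuineKTameRobustRows5
import HarnessLib

/-!
# Branch C / R-W, reading (U), M line: the M-SETTING twins of the R-W lane's W2-EXACT-DIFFERENT inhabited half-axes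
# (abc-iut cell, branch C, row «C:INH-M-TWIN-RESIDUE» item (a); seat abc-iut-C-cert-2 gen 8; C LEAD KEY 2026-08-27T13:11Z)

Record-only PROOF file (D-0012; 0 definitions, 0 `Prop` facts, nothing re-typed) of the abc-iut cell. TAKES NO SIDE on [IUTchIII] Cor. 3.12
(S. Mochizuki, *Inter-universal Teichmüller theory III*, Cor. 3.12 p. 173–174; Step (xi-f) p. 184) or on any author; «inhabited as typed» ≠
«asserted in print».

abc-iut-W-num-6's W2-EXACT-DIFFERENT inhabited half-axes (`RefBandsInhBand289111328125Diff` p523584, `RefBandsInhTypeBand99794037551104Diff`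
p523128; work list `HOME/abc-iut-W-num-6/refbands/KERNEL-INH-BANDS.tsv` v2, column «INH_W2exact_diff») are their K different-hook socket
`WRow.licence_triple_slot_of_localType_diff` (`Cor312LicenceTripleLocalTypeSlotDiff` p522218) applied to an arithmetic certificate
`RefBand.inhcell_<a>…_diff : hcell` discharged at explicit integers, with the local-type hook `hQ` and the different hook `hD` (abc-iut-w5-d180's
exact wild different `GenuineK.differentOrd_kOf_eq_wildUnit_of_triple`, `D = e + e/p₀ − 1` at the W2-unit pole `p₀`) discharged in the K term.
This seat's M different-hook socket `WRowM.licence_triple_slot_of_localType_diff` (`WRowLicenceTripleSocketMLocalTypeDiff`, gen 8 file 0) takes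
the SAME `Q`, `hQ`, `p₀`, `Dx`, `hD`, `hcell` — so each K theorem has an M twin «one apply away»: the SAME certificate BY NAME (its `decide` /
`norm_num` checks are not re-run here), the SAME envelope exponents, the SAME `j ≠ 1728` discharge, the SAME hook discharges VERBATIM; conclusion =
`Thm311ToCor312.Licence` at the M-LEVEL setting of the datum's own ideles `settingPrVolSharpM T.D hlog (tOfIdeleData T.D r) (tqM … r …) …` for
EVERY idele datum `r`, every analytic `logvK`, any `htq0/Sq/htq1` — the setting of the M books of record (`abc_of_SH_v11M_window_content` p461893
and its Szpiro-bad / stable companions), whose (U) binder therefore reads INHABITED AS TYPED on the same half-axes (exact different at `p₀`).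

THIS FILE (2 axes): `WRowM.licence_triple_289111328125_inhband_diff_M` ((hl0 : 956545 ≤ l); K theorem `WRow.licence_triple_289111328125_inhband_diff`, `RefBandsInhBand289111328125Diff`) · `WRowM.licence_triple_99794037551104_typeband_e6_diff_M` ((hl0 : 4091 ≤ l), hloc verbatim; K theorem `WRow.licence_triple_99794037551104_typeband_e6_diff`, `RefBandsInhTypeBand99794037551104Diff`)

HONEST SCOPE: OUR sharp containers and Dupuy–Hilado's typed (Ind1)/(Ind2); STRONGER-THAN-PRINT hull reading; a socket discharges nothing;
non-emptiness of the datum type, admissibility and Szpiro-badness NOT claimed; explicit hypothesis counts of the record books UNCHANGED; an M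
twin changes NO K-line census count; nothing about the printed GLOBAL inequality or the number-level corollary; typed ≠ proved; instantiated ≠
endorsed; no abc claim. [cite: Mochizuki2012, IUTchI Def. 3.1 (b),(c) pp. 61–62, Ex. 3.2 (iv) p. 71; IUTchIII Cor. 3.12 Step (xi-f) p. 184;
IUTchIV Prop. 1.1 p. 9, Prop. 1.2 (i)(ii) p. 10, Prop. 1.4 (ii) p. 13, Cor. 2.2 (ii) proof (P5) p. 46] [cite: DupuyHilado2025, §3.3, §3.4, §4.9, §4.12]
[claim: Mochizuki2012, status: disputed] for every IUT sentence. PROOF-ONLY: no definitions.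
-/

noncomputable section

open Set Function Metric NumberField IsDedekindDomain

namespace Summit.ABC.IUTFork.Conditional

open Thm311 Thm311.Real Cor312 Cor312Vol Cor312Prov Literature.IUT.LogThetaLattice Literature.IUT.LogVolume
  Literature.IUT.HodgeTheaters Literature.IUT.LogVolume.Cor22
open Literature.NumberTheory.NumberFields Literature.NumberTheory.GaloisRepresentations.Ultrametric
open Literature.NumberTheory.DiophantineGeometry Literature.NumberTheory.DiophantineGeometry.GenEll

/-- **M TWIN of `WRow.licence_triple_289111328125_inhband_diff`**: `5 ^ 11 * 31 * 191 + 2 ^ 8 * 7 ^ 13 * 89 * 859 ^ 2 = 3 ^ 30 * 13 ^ 4 * 277`, `(hl0 : 956545 ≤ l)`, EVERY genuine Θ-volume datum `T` over the Frey point, EVERY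
idele datum `r` of `T.D` ⇒ `Thm311ToCor312.Licence` at the M-LEVEL setting `settingPrVolSharpM T.D hlog (tOfIdeleData T.D r) (tqM … r …) …` — this seat's
M different-hook slot socket `WRowM.licence_triple_slot_of_localType_diff` at the K line's certificate `RefBand.inhcell_289111328125_diff` BY NAME (same envelope
exponents, same `j ≠ 1728` discharge, same local-type hook `hQ` and exact-different hook `hD` discharges VERBATIM). The M books' (U) binder is INHABITED
AS TYPED there. [cite: Mochizuki2012, IUTchIII Cor. 3.12 Step (xi-f) p. 184; IUTchIV Prop. 1.2 (i)(ii) p. 10, Cor. 2.2 (ii) proof (P5) p. 46]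
[cite: DupuyHilado2025, §3.3, §3.4, §4.9, §4.12] [claim: Mochizuki2012, status: disputed] -/
theorem WRowM.licence_triple_289111328125_inhband_diff_M {l : ℕ} (hl : l.Prime) (hl0 : 956545 ≤ l)
    (T : Cor22.ThetaVolumeDatumAt (ratPoint (((5 ^ 11 * 31 * 191 : ℕ) : ℚ) / (3 ^ 30 * 13 ^ 4 * 277 : ℕ))) l) :
    letI := T.instFieldF; letI := T.instNumberFieldF; letI := T.instAlgebraF; letI := T.instFieldK
    letI := T.instNumberFieldK; letI := T.instAlgebraK; letI := T.instFieldFbar; letI := T.instAlgebraFbar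
    letI := T.instAlgebraKFbar; letI := T.instIsElliptic
    ∀ {logvK : PadicLogsVal T.K} (hlog : LogvAnalyticVal logvK) (r : ThetaData.IdeleData T.D) (M : Type) [Field M] [NumberField M]
      (archPk : ∀ (j : (thetaIndexOfInitial T.D).Label) (vQ : (thetaIndexOfInitial T.D).VQ),
        Set ((logShellsOfInitialDH T.D logvK).Packet j vQ))
      (archSub : ∀ (j : (thetaIndexOfInitial T.D).Label) (v : (thetaIndexOfInitial T.D).V),
        Set ((logShellsOfInitialDH T.D logvK).Packet j ((thetaIndexOfInitial T.D).over v)))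
      (Ψ : ℤ → ∀ v : (thetaIndexOfInitial T.D).V, v ∈ (thetaIndexOfInitial T.D).Vbad →
        Set ((logShellsOfInitialDH T.D logvK).StarPacket v))
      (act : ℤ → ∀ v : (thetaIndexOfInitial T.D).V, v ∈ (thetaIndexOfInitial T.D).Vbad →
        (logShellsOfInitialDH T.D logvK).StarPacket v → Module.End ℚ ((logShellsOfInitialDH T.D logvK).StarPacket v))
      (Mmod : ℤ → ∀ j : (thetaIndexOfInitial T.D).LabelStar, Set ((logShellsOfInitialDH T.D logvK).GlobalPacket j.1))
      (region : ℤ → ∀ j : (thetaIndexOfInitial T.D).LabelStar, FinDivisor M → ∀ vQ : (thetaIndexOfInitial T.D).VQ,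
        Set ((logShellsOfInitialDH T.D logvK).Packet j.1 vQ))
      (n : ℤ) {HT : Type} {LogLink : HT → HT → Type} {IsFull : ∀ {s t : HT}, LogLink s t → Prop}
      (lat : LGPGaussianLogThetaLattice LogLink IsFull)
      {Frd : Type} {IsoF : Frd → Frd → Type} {Ob : Frd → Type} {realify : Frd → Frd} {Strip : Type}
      {IsoS : Strip → Strip → Type}
      {Mv : ∀ v : (thetaIndexOfInitial T.D).V, v ∈ (thetaIndexOfInitial T.D).Vbad → Type} [∀ v h, Monoid (Mv v h)]
      (sig : GlobalLGPFrobenioidSignature (thetaIndexOfInitial T.D).lstar (thetaIndexOfInitial T.D).V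
        (· ∈ (thetaIndexOfInitial T.D).Vbad) Frd IsoF Ob realify Strip IsoS Mv)
      (split : SplittingMonoids Mv) {ObΔ : Type}
      {N : ∀ v : (thetaIndexOfInitial T.D).V, v ∈ (thetaIndexOfInitial T.D).Vbad → Type} [∀ v h, Monoid (N v h)]
      (qData : QPilotData ObΔ N)
      (htq0 : ∀ (u : FinitePlace ℚ) (x : (thetaIndexOfInitial T.D).Fibre (Val.non u)),
        tqM T.D (ratChar u) u (natCast_ratChar_mem u) r x ≠ 0)
      (Sq : Finset (FinitePlace ℚ))
      (htq1 : ∀ (u : FinitePlace ℚ) (x : (thetaIndexOfInitial T.D).Fibre (Val.non u)), u ∉ Sq →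
        ‖tqM T.D (ratChar u) u (natCast_ratChar_mem u) r x‖ = 1),
      Thm311ToCor312.Licence
        (settingPrVolSharpM T.D hlog (tOfIdeleData T.D r) (fun u x => tqM T.D (ratChar u) u (natCast_ratChar_mem u) r x) M archPk
          archSub Ψ act Mmod region n lat sig split qData htq0 Sq htq1) :=
  WRowM.licence_triple_slot_of_localType_diff isABCTriple_frey289111328125 (by rw [Cor22.jInv_ratPoint_triple isABCTriple_frey289111328125]; norm_num) T
    (fun p => if p = 3 then 14 else if p = 5 then 4 else if p = 7 then 6 else if p = 13 then 1 else if p = 31 then 0 else if p = 89 then 0 else if p = 191 then 0 else if p = 277 then 0 else if p = 859 then 0 else 0) (fun p => if p = 3 then 14 else if p = 5 then 4 else if p = 7 then 6 else if p = 13 then 1 else if p = 31 then 0 else if p = 89 then 0 else if p = 191 then 0 else if p = 277 then 0 else if p = 859 then 0 else 0) (fun p e => (3 = p → e = 6 * l))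
    (by
      intro pp x _ hpp
      obtain rfl : pp = ⟨3, by norm_num⟩ := Subtype.ext hpp.symm
      have h := GenuineK.absRamificationIdx_kOf_eq_wildUnit_of_triple (p' := 5) (v := 30) isABCTriple_frey289111328125 T ⟨3, by norm_num⟩
        (Or.inl ⟨rfl, rfl⟩) (by simp; omega) (by norm_num) (by norm_num) (by norm_num) (by norm_num) (by norm_num) (by norm_num)
      rw [h x]; norm_num) 3 (fun e => e + e / 3 - 1)
    (by
      intro pp x _ hpp
      obtain rfl : pp = ⟨3, by norm_num⟩ := Subtype.ext hpp
      have h := GenuineK.differentOrd_kOf_eq_wildUnit_of_triple (p' := 5) (v := 30) isABCTriple_frey289111328125 T ⟨3, by norm_num⟩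
        (Or.inl ⟨rfl, rfl⟩) (by simp; omega) (by norm_num) (by norm_num) (by norm_num) (by norm_num) (by norm_num) (by norm_num)
      exact (h x).symm.le)
    (RefBand.inhcell_289111328125_diff hl hl0)

/-- **M TWIN of `WRow.licence_triple_99794037551104_typeband_e6_diff`**: `2 ^ 12 * 13 ^ 3 * 223 ^ 3 + 3 ^ 15 * 11 ^ 3 * 97 ^ 5 * 409 = 5 ^ 15 * 179 ^ 4 * 2141`, `(hl0 : 4091 ≤ l)`, data with the hooked local type `hloc`, EVERY genuine Θ-volume datum `T` over the Frey point, EVERY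
idele datum `r` of `T.D` ⇒ `Thm311ToCor312.Licence` at the M-LEVEL setting `settingPrVolSharpM T.D hlog (tOfIdeleData T.D r) (tqM … r …) …` — this seat's
M different-hook slot socket `WRowM.licence_triple_slot_of_localType_diff` at the K line's certificate `RefBand.inhcell_99794037551104_type_diff` BY NAME (same envelope
exponents, same `j ≠ 1728` discharge, same local-type hook `hQ` and exact-different hook `hD` discharges VERBATIM). The M books' (U) binder is INHABITED
AS TYPED there. [cite: Mochizuki2012, IUTchIII Cor. 3.12 Step (xi-f) p. 184; IUTchIV Prop. 1.2 (i)(ii) p. 10, Cor. 2.2 (ii) proof (P5) p. 46]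
[cite: DupuyHilado2025, §3.3, §3.4, §4.9, §4.12] [claim: Mochizuki2012, status: disputed] -/
theorem WRowM.licence_triple_99794037551104_typeband_e6_diff_M {l : ℕ} (hl : l.Prime) (hl0 : 4091 ≤ l)
    (T : Cor22.ThetaVolumeDatumAt (ratPoint (((2 ^ 12 * 13 ^ 3 * 223 ^ 3 : ℕ) : ℚ) / (5 ^ 15 * 179 ^ 4 * 2141 : ℕ))) l)
    (hloc : letI := T.instFieldF; letI := T.instNumberFieldF; letI := T.instAlgebraF; letI := T.instFieldK
      letI := T.instNumberFieldK; letI := T.instAlgebraK; letI := T.instFieldFbar; letI := T.instAlgebraFbar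
      letI := T.instAlgebraKFbar; letI := T.instIsElliptic
      haveI : Fact (Nat.Prime 97) := ⟨by norm_num⟩
      ∀ x₀ : (thetaIndex (pilotDataOfK T.D T.K)).Fibre (.inr ⟨97, by norm_num⟩),
        absRamificationIdx 97 (kOf (pilotDataOfK T.D T.K) 97 x₀) = 6 * l) :
    letI := T.instFieldF; letI := T.instNumberFieldF; letI := T.instAlgebraF; letI := T.instFieldK
    letI := T.instNumberFieldK; letI := T.instAlgebraK; letI := T.instFieldFbar; letI := T.instAlgebraFbar
    letI := T.instAlgebraKFbar; letI := T.instIsElliptic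
    ∀ {logvK : PadicLogsVal T.K} (hlog : LogvAnalyticVal logvK) (r : ThetaData.IdeleData T.D) (M : Type) [Field M] [NumberField M]
      (archPk : ∀ (j : (thetaIndexOfInitial T.D).Label) (vQ : (thetaIndexOfInitial T.D).VQ),
        Set ((logShellsOfInitialDH T.D logvK).Packet j vQ))
      (archSub : ∀ (j : (thetaIndexOfInitial T.D).Label) (v : (thetaIndexOfInitial T.D).V),
        Set ((logShellsOfInitialDH T.D logvK).Packet j ((thetaIndexOfInitial T.D).over v)))
      (Ψ : ℤ → ∀ v : (thetaIndexOfInitial T.D).V, v ∈ (thetaIndexOfInitial T.D).Vbad →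
        Set ((logShellsOfInitialDH T.D logvK).StarPacket v))
      (act : ℤ → ∀ v : (thetaIndexOfInitial T.D).V, v ∈ (thetaIndexOfInitial T.D).Vbad →
        (logShellsOfInitialDH T.D logvK).StarPacket v → Module.End ℚ ((logShellsOfInitialDH T.D logvK).StarPacket v))
      (Mmod : ℤ → ∀ j : (thetaIndexOfInitial T.D).LabelStar, Set ((logShellsOfInitialDH T.D logvK).GlobalPacket j.1))
      (region : ℤ → ∀ j : (thetaIndexOfInitial T.D).LabelStar, FinDivisor M → ∀ vQ : (thetaIndexOfInitial T.D).VQ,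
        Set ((logShellsOfInitialDH T.D logvK).Packet j.1 vQ))
      (n : ℤ) {HT : Type} {LogLink : HT → HT → Type} {IsFull : ∀ {s t : HT}, LogLink s t → Prop}
      (lat : LGPGaussianLogThetaLattice LogLink IsFull)
      {Frd : Type} {IsoF : Frd → Frd → Type} {Ob : Frd → Type} {realify : Frd → Frd} {Strip : Type}
      {IsoS : Strip → Strip → Type}
      {Mv : ∀ v : (thetaIndexOfInitial T.D).V, v ∈ (thetaIndexOfInitial T.D).Vbad → Type} [∀ v h, Monoid (Mv v h)]
      (sig : GlobalLGPFrobenioidSignature (thetaIndexOfInitial T.D).lstar (thetaIndexOfInitial T.D).V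
        (· ∈ (thetaIndexOfInitial T.D).Vbad) Frd IsoF Ob realify Strip IsoS Mv)
      (split : SplittingMonoids Mv) {ObΔ : Type}
      {N : ∀ v : (thetaIndexOfInitial T.D).V, v ∈ (thetaIndexOfInitial T.D).Vbad → Type} [∀ v h, Monoid (N v h)]
      (qData : QPilotData ObΔ N)
      (htq0 : ∀ (u : FinitePlace ℚ) (x : (thetaIndexOfInitial T.D).Fibre (Val.non u)),
        tqM T.D (ratChar u) u (natCast_ratChar_mem u) r x ≠ 0)
      (Sq : Finset (FinitePlace ℚ))
      (htq1 : ∀ (u : FinitePlace ℚ) (x : (thetaIndexOfInitial T.D).Fibre (Val.non u)), u ∉ Sq →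
        ‖tqM T.D (ratChar u) u (natCast_ratChar_mem u) r x‖ = 1),
      Thm311ToCor312.Licence
        (settingPrVolSharpM T.D hlog (tOfIdeleData T.D r) (fun u x => tqM T.D (ratChar u) u (natCast_ratChar_mem u) r x) M archPk
          archSub Ψ act Mmod region n lat sig split qData htq0 Sq htq1) :=
  WRowM.licence_triple_slot_of_localType_diff isABCTriple_frey99794037551104 (by rw [Cor22.jInv_ratPoint_triple isABCTriple_frey99794037551104]; norm_num) T
    (fun p => if p = 3 then 7 else if p = 5 then 7 else if p = 11 then 1 else if p = 13 then 1 else if p = 97 then 2 else if p = 179 then 1 else if p = 223 then 1 else if p = 409 then 0 else if p = 2141 then 0 else 0) (fun p => if p = 3 then 7 else if p = 5 then 7 else if p = 11 then 1 else if p = 13 then 1 else if p = 97 then 2 else if p = 179 then 1 else if p = 223 then 1 else if p = 409 then 0 else if p = 2141 then 0 else 0) (fun p e => (5 = p → e = 20 * l) ∧ (97 = p → e = 6 * l))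
    (by
      intro pp x _
      refine ⟨fun hpp => ?_, fun hpp => ?_⟩
      · obtain rfl : pp = ⟨5, by norm_num⟩ := Subtype.ext hpp.symm
        have h := GenuineK.absRamificationIdx_kOf_eq_wildUnit_of_triple (p' := 3) (v := 15) isABCTriple_frey99794037551104 T ⟨5, by norm_num⟩
          (Or.inr ⟨rfl, rfl⟩) (by simp; omega) (by norm_num) (by norm_num) (by norm_num) (by norm_num) (by norm_num) (by norm_num)
        rw [h x]; norm_num
      · obtain rfl : pp = ⟨97, by norm_num⟩ := Subtype.ext hpp.symm
        exact hloc x) 5 (fun e => e + e / 5 - 1)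
    (by
      intro pp x _ hpp
      obtain rfl : pp = ⟨5, by norm_num⟩ := Subtype.ext hpp
      have h := GenuineK.differentOrd_kOf_eq_wildUnit_of_triple (p' := 3) (v := 15) isABCTriple_frey99794037551104 T ⟨5, by norm_num⟩
        (Or.inr ⟨rfl, rfl⟩) (by simp; omega) (by norm_num) (by norm_num) (by norm_num) (by norm_num) (by norm_num) (by norm_num)
      exact (h x).symm.le)
    (RefBand.inhcell_99794037551104_type_diff hl hl0)

end Summit.ABC.IUTFork.Conditional

end
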